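import Literature.NumberTheory.Transcendental.ZilberFieldSaturationMain
import Literature.RingTheory.KrullDimension.FieldOfDefinition
import Literature.Combinatorics.Matroid.RelRankFinitary
import HarnessLib

/-!
# Strongly exponentially-algebraically closed fields are generically strongly Γ-closed

M. Bays, J. Kirby, *Pseudo-exponential maps, variants, and quasiminimality*, Algebra & Number
Theory 12 (2018) 493–549, §11: Def. 11.1 defines *generic strong Γ-closedness over `K`* (GSΓC,
`GammaField.IsGenericallyStronglyGammaClosedOver` of `ZilberGenericClosedness.lean`) and Prop. 11.5
derives it, over a Γ-closed `K`, from generic Γ-closedness and the weak Zilber–Pink theorem.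
Together with Prop. 11.2 (GSΓC ⟹ `ℵ₀`-saturation) this is what makes the quasiminimality proofs
of Thm 1.5 and Thm 1.2 (= Zilber 2005, Thm 1.2) work.

This file proves GSΓC over **every** `ℚ`-subspace `K` directly from Zilber's axiom of *strong*
exponential-algebraic closedness (`Literature.NumberTheory.Transcendental.IsStronglyExpAlgClosed`,
"axiom 4"), for `F` algebraically closed:

* `ZilberGSGC.isGenericallyStronglyGammaClosedOver_of_isStronglyExpAlgClosed`,
* `IsZilberField.isGenericallyStronglyGammaClosedOver` — in particular for Zilber fields;
* `ZilberGSGC.exists_gammaPt_linIndepOver_of_isStronglyExpAlgClosed` — the same conclusion for a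
  single pair `(V, α)` with `V` defined over *any* subfield algebraic over `K₀(α)` (in particular
  over the full Γ-field `⟨K α⟩` with its division points,
  `ZilberGSGC.exists_gammaPt_linIndepOver_of_isDefinedOver_fieldOf`), which is the form in which
  loci of good bases arise in the proof of Prop. 11.2.

No Zilber–Pink-type finiteness, no Kummer theory and no Schanuel property enter: the argument is
that of Bays–Kirby's proof of Prop. 11.5 with the *minimal* coset containing the point in place of
the subgroup supplied there by weak Zilber–Pink, and genericity over finitely generated fields (as
SEAC provides it) in place of Zariski density. In outline (notation of Def. 11.1: `V ⊆ Gⁿ`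
irreducible free rotund of dimension `n` defined over `K(α)`, `α = (a, exp a)`, `a` independent
over `K`, `X = K + ℚa ◁ F`, `W = Loc(α, V/K)` strongly rotund; `K₀ = ℚ(Γ(K))`):

1. choose a finitely generated `k ⊆ K₀` with `td(α/k) = td(α/K₀)` (relative rank in the
   algebraic matroid is attained over a finite set, `Matroid.exists_finite_subset_relRank_eq`) and
   such that `V` is defined over `L = k(α)` (`IsDefinedOver.exists_finset_closure_union`);
2. SEAC gives `(g, exp g) ∈ V` generic over `L`; suppose `g` dependent over `X`, and let `M ≠ 0`
   be the integer matrix of *all* relations of `ζ = (a, g)` over `K` (`exists_relation_matrix`: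
   `rk M = s ≥ 1`, `ldim(g/X) = n - s`);
3. `p = (ζ, exp ζ) ∈ W` is a generic point of `W` over `k`
   (`isGenericPt_vanishingIdeal_image_prodPt`: substitute `α` and use genericity of `(g, exp g)`
   over `L ⊇ k(α)`), while `[M] p = (Mζ, exp Mζ)` has coordinates in `K₀`;
4. strong rotundity `dim [M] W > rk M` transfers to `td([M] p / k) ≥ s + 1`: the `F`-closure of
   `[M](W ∩ G)` has dimension at most that of its `k`-closure
   (`Literature.RingTheory.KrullDimension.ringKrullDim_quotient_vanishingIdeal_le`), whose
   coordinate ring is `k[[M] p]` by genericity (`zariskiDim_image_matrixAct_le_trdeg`);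
5. count transcendence degrees over `K₀` (relative ranks in the algebraic matroid of `F/ℚ`): on
   the one hand `td(p/K₀) = td(α/K₀) + td(g, exp g / K₀(α)) ≥ td(α/K₀) + (n - s)` since
   `X ◁ F`; on the other hand, as `[M] p ⊆ K₀`,
   `td(p/K₀) ≤ td(p / k ∪ [M]p) = td(p/k) - td([M]p/k) ≤ (td(α/k) + n) - (s + 1)`, using
   `td(α/k) = td(α/K₀)` and `td(g, exp g / L) ≤ dim V = n`
   (`Literature.RingTheory.KrullDimension.trdeg_adjoin_le_of_mem`) — a contradiction.

Supporting results of independent use: `exists_relation_matrix` (integer matrices of all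
`ℚ`-linear relations modulo a subspace), `IsDefinedOver.exists_finset_closure_union`,
`IsDefinedOver.of_le`, `mem_vanishingIdeal_image_matrixAct_iff'` (two-field version of the
description of `I([M] S)`), `toENat_trdeg_adjoin_subfield_eq_relRank`.

## References

* M. Bays, J. Kirby, *Pseudo-exponential maps, variants, and quasiminimality*, Algebra & Number
  Theory 12 (2018) 493–549 (arXiv:1512.04262): Def. 4.1, Def. 7.1, Prop. 7.3, Def. 11.1,
  Prop. 11.2, Prop. 11.5 (and its proof, displays (11.1)–(11.6)), Cor. 11.7.
* B. Zilber, *Pseudo-exponentiation on algebraically closed fields of characteristic zero*,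
  Ann. Pure Appl. Logic 132 (2005) 67–95, §1 (axiom (SEC)), §5.
-/

noncomputable section

open Set MvPolynomial

universe u

namespace Literature.NumberTheory.Transcendental

namespace ZilberGSGC

open GammaField Literature.ModelTheory.ExponentialFields.ExponentialRing ZilberSaturationMain

/-! ### Integer relation matrices -/

section RelationMatrix

variable {F : Type*} [Field F] [CharZero F]

/-- A rational vector has a positive integer multiple with integer entries. [folklore] -/
theorem exists_intVec_eq_natMul {N : ℕ} (v : Fin N → ℚ) :
    ∃ (D : ℕ) (w : Fin N → ℤ), 0 < D ∧ ∀ j, (w j : ℚ) = (D : ℚ) * v j := by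
  classical
  refine ⟨∏ j, (v j).den, fun j => (((∏ i, (v i).den) / (v j).den : ℕ) : ℤ) * (v j).num,
    Finset.prod_pos fun j _ => (v j).den_pos, fun j => ?_⟩
  have hdvd : (v j).den ∣ ∏ i, (v i).den := Finset.dvd_prod_of_mem _ (Finset.mem_univ j)
  have hD : ((∏ i, (v i).den : ℕ) : ℚ) = (((∏ i, (v i).den) / (v j).den : ℕ) : ℚ) * (v j).den := by
    rw [← Nat.cast_mul, Nat.div_mul_cancel hdvd]
  rw [hD, Int.cast_mul, Int.cast_natCast, mul_assoc, Rat.den_mul_eq_num]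

/-- **Integer relation matrices.** For a `ℚ`-subspace `Λ ⊆ F` and a tuple `ζ : Fin N → F` there
is an integer `N × N` matrix `M` whose rows are `ℚ`-linear relations of `ζ` modulo `Λ`
(`∑ⱼ Mᵢⱼ ζⱼ ∈ Λ`) and span *all* such relations: `rk M = s` with `ldim_ℚ(ζ/Λ) + s = N`
(rank–nullity for `ℚ^N → F ⧸ Λ`, `eᵢ ↦ ζᵢ`; a basis of the kernel is rescaled to integer vectors
and padded with zero rows). [folklore] -/
theorem exists_relation_matrix (Λ : Submodule ℚ F) {N : ℕ} (ζ : Fin N → F) :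
    ∃ (s : ℕ) (M : Matrix (Fin N) (Fin N) ℤ), (M.map (Int.cast : ℤ → ℚ)).rank = s ∧
      (∀ i, ∑ j, (M i j : F) * ζ j ∈ Λ) ∧ ldim Λ (Submodule.span ℚ (range ζ)) + s = N := by
  classical
  let φ : (Fin N → ℚ) →ₗ[ℚ] F ⧸ Λ := Fintype.linearCombination ℚ (Λ.mkQ ∘ ζ)
  let R : Submodule ℚ (Fin N → ℚ) := LinearMap.ker φ
  set s : ℕ := Module.finrank ℚ R with hs
  have hφ : ∀ v : Fin N → ℚ, φ v = Λ.mkQ (∑ j, (v j : F) * ζ j) := by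
    intro v
    simp only [φ, Fintype.linearCombination_apply, Function.comp_apply, map_sum]
    refine Finset.sum_congr rfl fun j _ => ?_
    rw [← map_smul, Rat.smul_def]
  have hrange : Module.finrank ℚ (LinearMap.range φ) = ldim Λ (Submodule.span ℚ (range ζ)) := by
    have : LinearMap.range φ = (Submodule.span ℚ (range ζ)).map Λ.mkQ := by
      rw [Fintype.range_linearCombination, Submodule.map_span, ← Set.range_comp]
    rw [ldim, this]
  have hsN : ldim Λ (Submodule.span ℚ (range ζ)) + s = N := by
    rw [← hrange, hs]
    simpa using LinearMap.finrank_range_add_finrank_ker φ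
  have hsle : s ≤ N := by omega
  -- integer rows from a basis of the relation space
  let b := Module.finBasis ℚ R
  have hrow : ∀ l : Fin (Module.finrank ℚ R), ∃ (D : ℕ) (w : Fin N → ℤ), 0 < D ∧
      ∀ j, (w j : ℚ) = (D : ℚ) * (b l : Fin N → ℚ) j := fun l => exists_intVec_eq_natMul _
  choose D w hD hw using hrow
  let M : Matrix (Fin N) (Fin N) ℤ := fun i j => if h : (i : ℕ) < s then w ⟨i, h⟩ j else 0
  have hMrow : ∀ i : Fin N, (M.map (Int.cast : ℤ → ℚ)) i =
      if h : (i : ℕ) < s then (D ⟨i, h⟩ : ℚ) • (b ⟨i, h⟩ : Fin N → ℚ) else 0 := by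
    intro i
    funext j
    by_cases h : (i : ℕ) < s
    · simp only [Matrix.map_apply, M, dif_pos h, Pi.smul_apply, smul_eq_mul]
      exact hw ⟨i, h⟩ j
    · simp only [Matrix.map_apply, M, dif_neg h, Int.cast_zero, Pi.zero_apply]
  refine ⟨s, M, ?_, ?_, hsN⟩
  · -- `rk M = s`: the rows span the relation space `R`
    rw [Matrix.rank_eq_finrank_span_row, hs]
    have hspan : Submodule.span ℚ (range (M.map (Int.cast : ℤ → ℚ)).row) = R := by
      apply le_antisymm
      · refine Submodule.span_le.2 ?_
        rintro _ ⟨i, rfl⟩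
        change (M.map (Int.cast : ℤ → ℚ)) i ∈ R
        rw [hMrow i]
        by_cases h : (i : ℕ) < s
        · rw [dif_pos h]
          exact R.smul_mem _ (b ⟨i, h⟩).2
        · rw [dif_neg h]
          exact R.zero_mem
      · -- every basis vector is a rational multiple of a row
        have hb : ∀ l : Fin (Module.finrank ℚ R), (b l : Fin N → ℚ) ∈
            Submodule.span ℚ (range (M.map (Int.cast : ℤ → ℚ)).row) := by
          intro l
          have hl : ((Fin.castLE hsle l : Fin N) : ℕ) < s := l.isLt
          have hl' : (⟨((Fin.castLE hsle l : Fin N) : ℕ), hl⟩ : Fin (Module.finrank ℚ R)) = l :=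
            Fin.ext rfl
          have hrowl : (M.map (Int.cast : ℤ → ℚ)) (Fin.castLE hsle l) =
              (D l : ℚ) • (b l : Fin N → ℚ) := by
            rw [hMrow, dif_pos hl, hl']
          have hmem : (M.map (Int.cast : ℤ → ℚ)) (Fin.castLE hsle l) ∈
              Submodule.span ℚ (range (M.map (Int.cast : ℤ → ℚ)).row) :=
            Submodule.subset_span ⟨Fin.castLE hsle l, rfl⟩
          rw [hrowl] at hmem
          have hD0 : (D l : ℚ) ≠ 0 := by exact_mod_cast (hD l).ne'
          have := Submodule.smul_mem _ (D l : ℚ)⁻¹ hmem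
          rwa [smul_smul, inv_mul_cancel₀ hD0, one_smul] at this
        intro v hv
        have hv' : (⟨v, hv⟩ : R) ∈ Submodule.span ℚ (range b) := by
          rw [b.span_eq]; exact Submodule.mem_top
        have h1 : (R.subtype ⟨v, hv⟩ : Fin N → ℚ) ∈ Submodule.span ℚ (R.subtype '' range b) :=
          Submodule.apply_mem_span_image_of_mem_span R.subtype hv'
        have h2 : Submodule.span ℚ (R.subtype '' range b) ≤
            Submodule.span ℚ (range (M.map (Int.cast : ℤ → ℚ)).row) := by
          rw [Submodule.span_le]
          rintro _ ⟨_, ⟨l, rfl⟩, rfl⟩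
          exact hb l
        exact h2 h1
    rw [hspan]
  · -- the rows are relations
    intro i
    by_cases h : (i : ℕ) < s
    · have hker : φ (b ⟨i, h⟩ : Fin N → ℚ) = 0 := LinearMap.mem_ker.1 (b ⟨i, h⟩).2
      rw [hφ, Submodule.mkQ_apply, Submodule.Quotient.mk_eq_zero] at hker
      have heq : ∑ j, (M i j : F) * ζ j = (D ⟨i, h⟩ : F) * ∑ j, ((b ⟨i, h⟩ : Fin N → ℚ) j : F) * ζ j := by
        rw [Finset.mul_sum]
        refine Finset.sum_congr rfl fun j _ => ?_
        have : ((M i j : ℤ) : F) = ((D ⟨i, h⟩ : ℚ) * (b ⟨i, h⟩ : Fin N → ℚ) j : ℚ) := by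
          rw [← hw ⟨i, h⟩ j]
          simp only [M, dif_pos h, Rat.cast_intCast]
        rw [this, Rat.cast_mul, Rat.cast_natCast, mul_assoc]
      rw [heq]
      have hm := Λ.smul_mem (D ⟨i, h⟩ : ℚ) hker
      rwa [Rat.smul_def, Rat.cast_natCast] at hm
    · have : ∑ j, (M i j : F) * ζ j = 0 := by
        refine Finset.sum_eq_zero fun j _ => ?_
        simp only [M, dif_neg h, Int.cast_zero, zero_mul]
      rw [this]
      exact Λ.zero_mem

end RelationMatrix

/-! ### Linear dimension of independent tuples -/

section LDim

variable {F : Type*} [Field F] [CharZero F]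

/-- `ldim_ℚ(g/Λ) ≤ n` for an `n`-tuple `g`, with equality only if `g` is linearly independent over
`Λ`. [folklore] -/
theorem ldim_lt_of_not_linIndepOver {Λ : Submodule ℚ F} {n : ℕ} {g : Fin n → F}
    (hg : ¬ LinIndepOver Λ g) : ldim Λ (Submodule.span ℚ (range g)) < n := by
  rw [linIndepOver_iff, linearIndependent_iff_card_eq_finrank_span, Fintype.card_fin] at hg
  have hle : Set.finrank ℚ (range (Λ.mkQ ∘ g)) ≤ n := by
    simpa using finrank_range_le_card (R := ℚ) (Λ.mkQ ∘ g)
  have hldim : ldim Λ (Submodule.span ℚ (range g)) = Set.finrank ℚ (range (Λ.mkQ ∘ g)) := by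
    rw [ldim, Submodule.map_span, ← Set.range_comp, Set.finrank]
  rw [hldim]
  omega

/-- `span (range (Fin.append a g)) = span (range a) ⊔ span (range g)`. [folklore] -/
theorem span_range_append {r n : ℕ} (a : Fin r → F) (g : Fin n → F) :
    Submodule.span ℚ (range (Fin.append a g)) =
      Submodule.span ℚ (range a) ⊔ Submodule.span ℚ (range g) := by
  rw [ZilberHomogeneity.range_append, Submodule.span_union]

end LDim

/-! ### Points: `(α, β)`, `(a, exp a)` -/

section Points

variable {R : Type*}

/-- The coordinates of `(α, β)` are those of `α` and of `β`. [folklore] -/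
theorem range_prodPt {r n : ℕ} (α : Fin r ⊕ Fin r → R) (β : Fin n ⊕ Fin n → R) :
    range (prodPt α β) = range α ∪ range β := by
  rw [prodPt, Set.Sum.elim_range, ZilberHomogeneity.range_append, ZilberHomogeneity.range_append]
  ext x
  simp only [mem_union, mem_range, Function.comp_apply]
  constructor
  · rintro ((⟨i, rfl⟩ | ⟨i, rfl⟩) | (⟨i, rfl⟩ | ⟨i, rfl⟩))
    · exact Or.inl ⟨_, rfl⟩
    · exact Or.inr ⟨_, rfl⟩
    · exact Or.inl ⟨_, rfl⟩
    · exact Or.inr ⟨_, rfl⟩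
  · rintro (⟨j | j, rfl⟩ | ⟨j | j, rfl⟩)
    · exact Or.inl (Or.inl ⟨j, rfl⟩)
    · exact Or.inr (Or.inl ⟨j, rfl⟩)
    · exact Or.inl (Or.inr ⟨j, rfl⟩)
    · exact Or.inr (Or.inr ⟨j, rfl⟩)

variable [Field R] [Literature.ModelTheory.ExponentialFields.ExponentialRing R]

/-- `((a, exp a), (g, exp g)) = ((a, g), exp (a, g))`. [folklore] -/
theorem prodPt_gammaPt {r n : ℕ} (a : Fin r → R) (g : Fin n → R) :
    prodPt (gammaPt a) (gammaPt g) = gammaPt (Fin.append a g) := by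
  funext j
  rcases j with (i | i)
  · simp only [prodPt_inl, gammaPt_inl]; rfl
  · simp only [prodPt_inr, gammaPt_inr]
    induction i using Fin.addCases with
    | left i => simp [gammaPt]
    | right i => simp [gammaPt]

/-- `(a, exp a)` lies in the torus. [folklore] -/
theorem gammaPt_mem_torusLocus {r : ℕ} (a : Fin r → R) : gammaPt a ∈ torusLocus R r :=
  fun i => exp_ne_zero (a i)

omit [Literature.ModelTheory.ExponentialFields.ExponentialRing R] in
/-- `(α, β)` lies in the torus if `α` and `β` do. [folklore] -/
theorem prodPt_mem_torusLocus {r n : ℕ} {α : Fin r ⊕ Fin r → R} {β : Fin n ⊕ Fin n → R}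
    (hα : α ∈ torusLocus R r) (hβ : β ∈ torusLocus R n) : prodPt α β ∈ torusLocus R (r + n) := by
  intro i
  simp only [prodPt_inr]
  induction i using Fin.addCases with
  | left i => simpa using hα i
  | right i => simpa using hβ i

omit [Literature.ModelTheory.ExponentialFields.ExponentialRing R] in
/-- The coordinates of `[M] p` lie in the subfield generated by the coordinates of `p`.
[folklore] -/
theorem matrixAct_mem_closure_range {N : ℕ} (M : Matrix (Fin N) (Fin N) ℤ) (p : Fin N ⊕ Fin N → R)
    (j : Fin N ⊕ Fin N) : matrixAct M p j ∈ Subfield.closure (range p) := by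
  rcases j with (i | i)
  · rw [matrixAct_inl]
    refine Subfield.sum_mem _ fun j _ => Subfield.mul_mem _ (Subfield.intCast_mem _ _) ?_
    exact Subfield.subset_closure ⟨_, rfl⟩
  · rw [matrixAct_inr]
    refine Subfield.prod_mem _ fun j _ => Subfield.zpow_mem _ ?_ _
    exact Subfield.subset_closure ⟨_, rfl⟩

end Points

/-! ### Fields of definition: descending to a finitely generated subfield -/

section Definition

variable {F : Type*} [Field F]

/-- Membership in `Subfield.closure (B ∪ T)` only involves finitely many elements of `B`.
[folklore] -/
theorem exists_finset_mem_closure_union {B T : Set F} {c : F} (hc : c ∈ Subfield.closure (B ∪ T)) :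
    ∃ C : Finset F, ↑C ⊆ B ∧ c ∈ Subfield.closure (↑C ∪ T) := by
  classical
  induction hc using Subfield.closure_induction with
  | mem x hx =>
    rcases hx with hx | hx
    · exact ⟨{x}, by simpa using hx, Subfield.subset_closure (Or.inl (by simp))⟩
    · exact ⟨∅, by simp, Subfield.subset_closure (Or.inr hx)⟩
  | one => exact ⟨∅, by simp, Subfield.one_mem _⟩
  | add x y _ _ hx hy =>
    obtain ⟨C₁, hC₁, hx⟩ := hx
    obtain ⟨C₂, hC₂, hy⟩ := hy
    refine ⟨C₁ ∪ C₂, by simp [hC₁, hC₂], Subfield.add_mem _ ?_ ?_⟩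
    · exact Subfield.closure_mono (union_subset_union_left _ (by simp)) hx
    · exact Subfield.closure_mono (union_subset_union_left _ (by simp)) hy
  | neg x _ hx =>
    obtain ⟨C, hC, hx⟩ := hx
    exact ⟨C, hC, Subfield.neg_mem _ hx⟩
  | inv x _ hx =>
    obtain ⟨C, hC, hx⟩ := hx
    exact ⟨C, hC, Subfield.inv_mem _ hx⟩
  | mul x y _ _ hx hy =>
    obtain ⟨C₁, hC₁, hx⟩ := hx
    obtain ⟨C₂, hC₂, hy⟩ := hy
    refine ⟨C₁ ∪ C₂, by simp [hC₁, hC₂], Subfield.mul_mem _ ?_ ?_⟩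
    · exact Subfield.closure_mono (union_subset_union_left _ (by simp)) hx
    · exact Subfield.closure_mono (union_subset_union_left _ (by simp)) hy

variable {ι : Type*}

/-- A variety defined over a subfield is defined over every larger subfield. [folklore] -/
theorem _root_.Literature.NumberTheory.Transcendental.IsDefinedOver.of_le {S S' : Subfield F}
    (hle : S ≤ S') {W : Set (ι → F)} (h : IsDefinedOver S W) : IsDefinedOver S' W := by
  obtain ⟨I, rfl⟩ := h
  letI : Algebra S S' := (Subfield.inclusion hle).toAlgebra
  haveI : IsScalarTower S S' F := IsScalarTower.of_algebraMap_eq fun _ => rfl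
  refine ⟨I.map (MvPolynomial.map (algebraMap S S')), ?_⟩
  ext x
  simp only [mem_zeroLocus_iff]
  constructor
  · intro hx p hp
    refine Submodule.span_induction (p := fun p _ => aeval x p = 0) ?_ ?_ ?_ ?_ hp
    · rintro _ ⟨q, hq, rfl⟩
      rw [aeval_map_algebraMap]
      exact hx q hq
    · simp
    · intro p q _ _ hp hq
      rw [map_add, hp, hq, add_zero]
    · intro a p _ hp
      rw [smul_eq_mul, map_mul, hp, mul_zero]
  · intro hx p hp
    have := hx (MvPolynomial.map (algebraMap S S') p) (Ideal.mem_map_of_mem _ hp)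
    rwa [aeval_map_algebraMap] at this

/-- If `W` is cut out by finitely many polynomials over `S` all of whose coefficients lie in the
subfield `S' ⊆ S`, then `W` is defined over `S'`. [folklore] -/
theorem _root_.Literature.NumberTheory.Transcendental.IsDefinedOver.of_coeffs_mem {S' S : Subfield F}
    (hle : S' ≤ S) {W : Set (ι → F)} (gs : Finset (MvPolynomial ι S))
    (hW : W = zeroLocus F (Ideal.span (gs : Set (MvPolynomial ι S))))
    (hcoef : ∀ p ∈ gs, ∀ c ∈ p.coeffs, (c : F) ∈ S') : IsDefinedOver S' W := by
  classical
  letI : Algebra S' S := (Subfield.inclusion hle).toAlgebra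
  haveI : IsScalarTower S' S F := IsScalarTower.of_algebraMap_eq fun _ => rfl
  -- every generator lifts to `S'[X]`
  have hlift : ∀ p ∈ gs, ∃ q : MvPolynomial ι S', MvPolynomial.map (algebraMap S' S) q = p := by
    intro p hp
    change p ∈ Set.range (MvPolynomial.map (algebraMap S' S))
    rw [mem_range_map_iff_coeffs_subset]
    intro c hc
    exact ⟨⟨c, hcoef p hp c (Finset.mem_coe.1 hc)⟩, Subtype.ext rfl⟩
  choose q hq using hlift
  refine ⟨Ideal.span (Set.range fun p : gs => q p.1 p.2), ?_⟩
  rw [hW]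
  ext x
  rw [zeroLocus_span, zeroLocus_span]
  simp only [Set.mem_setOf_eq, Set.forall_mem_range, Subtype.forall, Finset.mem_coe]
  refine forall₂_congr fun p hp => ?_
  conv_lhs => rw [← hq p hp, aeval_map_algebraMap]

variable [Finite ι]

/-- **Fields of definition descend to finitely generated subfields of a generating set**: if
`W ⊆ F^ι` is defined over the subfield generated by `B ∪ T`, then it is defined over the subfield
generated by `C ∪ T` for some finite `C ⊆ B` (the defining ideal is finitely generated, and the
finitely many coefficients involved lie in such a subfield,
`MvPolynomial.mem_range_map_iff_coeffs_subset`). [folklore] -/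
theorem _root_.Literature.NumberTheory.Transcendental.IsDefinedOver.exists_finset_closure_union
    {B T : Set F} {W : Set (ι → F)} (h : IsDefinedOver (Subfield.closure (B ∪ T)) W) :
    ∃ C : Finset F, ↑C ⊆ B ∧ IsDefinedOver (Subfield.closure (↑C ∪ T)) W := by
  classical
  obtain ⟨I, hI⟩ := h
  obtain ⟨gs, hgs⟩ :=
    (inferInstance : IsNoetherianRing (MvPolynomial ι (Subfield.closure (B ∪ T)))).noetherian I
  -- finitely many elements of `B` for each coefficient
  have hcoef : ∀ c : Subfield.closure (B ∪ T), ∃ C : Finset F, ↑C ⊆ B ∧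
      (c : F) ∈ Subfield.closure (↑C ∪ T) :=
    fun c => exists_finset_mem_closure_union c.2
  choose Cc hCcB hCc using hcoef
  let C : Finset F := gs.biUnion fun p => p.coeffs.biUnion Cc
  have hCB : (C : Set F) ⊆ B := by
    intro x hx
    simp only [C, Finset.coe_biUnion, Finset.mem_coe, mem_iUnion] at hx
    obtain ⟨p, -, c, -, hx⟩ := hx
    exact hCcB c hx
  have hle : Subfield.closure (↑C ∪ T) ≤ Subfield.closure (B ∪ T) :=
    Subfield.closure_mono (union_subset_union_left _ hCB)
  refine ⟨C, hCB, IsDefinedOver.of_coeffs_mem hle gs (by rw [hI, ← hgs]) fun p hp c hc => ?_⟩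
  refine Subfield.closure_mono (union_subset_union_left _ ?_) (hCc c)
  intro x hx
  simp only [C, Finset.coe_biUnion, Finset.mem_coe, mem_iUnion]
  exact ⟨p, hp, c, hc, hx⟩

end Definition

/-! ### Genericity over `L ⊇ k(α)` makes `(α, ξ)` generic over `k` -/

section GenericTransfer

variable {F : Type u} [Field F] {k E : Type u} [Field k] [Field E] [Algebra k F] [Algebra E F]
  [Algebra k E] [IsScalarTower k E F] {r n : ℕ}

/-- **Substituting `α`.** For `α` with coordinates in `E ⊇ k` there is a substitution map
`f ↦ f(α, ·)` from `k[X_{(r+n) ⊕ (r+n)}]` to `E[X_{n ⊕ n}]` with `f(α, ·)(v) = f(α, v)` for all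
`v ∈ F^{n ⊕ n}` (evaluate the first blocks of variables at the constants `α`). [folklore] -/
theorem exists_subst_prodPt (α : Fin r ⊕ Fin r → E) :
    ∃ φ : MvPolynomial (Fin (r + n) ⊕ Fin (r + n)) k → MvPolynomial (Fin n ⊕ Fin n) E,
      ∀ (f : MvPolynomial (Fin (r + n) ⊕ Fin (r + n)) k) (v : Fin n ⊕ Fin n → F),
        aeval v (φ f) = aeval (prodPt (algebraMap E F ∘ α) v) f := by
  -- the images of the variables
  let w : Fin (r + n) ⊕ Fin (r + n) → MvPolynomial (Fin n ⊕ Fin n) E :=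
    Sum.elim (Fin.addCases (fun i => C (α (Sum.inl i))) fun i => X (Sum.inl i))
      (Fin.addCases (fun i => C (α (Sum.inr i))) fun i => X (Sum.inr i))
  have hw : ∀ (v : Fin n ⊕ Fin n → F) (j : Fin (r + n) ⊕ Fin (r + n)),
      aeval v (w j) = prodPt (algebraMap E F ∘ α) v j := by
    intro v j
    rcases j with (i | i)
    · simp only [w, Sum.elim_inl, prodPt_inl]
      induction i using Fin.addCases with
      | left i => simp
      | right i => simp
    · simp only [w, Sum.elim_inr, prodPt_inr]
      induction i using Fin.addCases with
      | left i => simp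
      | right i => simp
  refine ⟨fun f => aeval w f, fun f v => ?_⟩
  let ψ : MvPolynomial (Fin n ⊕ Fin n) E →ₐ[k] F := (aeval v).restrictScalars k
  have h := congrArg (fun φ => φ f) (MvPolynomial.comp_aeval (R := k) w ψ)
  simp only [AlgHom.coe_comp, Function.comp_apply] at h
  have hψ : (fun i => ψ (w i)) = prodPt (algebraMap E F ∘ α) v := funext fun j => hw v j
  rw [hψ] at h
  exact h

/-- **Genericity transfer.** Let `V ⊆ W₀ ⊆ F^{n ⊕ n}`, `z ∈ V`, and suppose every polynomial over
`E` vanishing at `z` vanishes on `W₀` (`z` is generic in `W₀` over `E`). Then for `α` with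
coordinates in `E`, the point `(α, z)` is a generic point over `k ⊆ E` of the `k`-locus of
`{α} × V`: `I((α, z)/k) = I_k({α} × V)`. (A polynomial `f` over `k` with `f(α, z) = 0` gives
`f(α, ·)` over `E` vanishing at `z`, hence on `W₀ ⊇ V`.) This is how genericity over a finitely
generated field containing `k(α)`, as provided by strong exponential-algebraic closedness, is used.
[cite: BaysKirby2018ANT, Prop. 11.5 (proof)] -/
theorem isGenericPt_vanishingIdeal_image_prodPt (α : Fin r ⊕ Fin r → E)
    {W₀ V : Set (Fin n ⊕ Fin n → F)} (hVW : V ⊆ W₀) {z : Fin n ⊕ Fin n → F} (hzV : z ∈ V)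
    (hgen : ∀ f : MvPolynomial (Fin n ⊕ Fin n) E, aeval z f = 0 → ∀ v ∈ W₀, aeval v f = 0) :
    IsGenericPt (vanishingIdeal k (prodPt (algebraMap E F ∘ α) '' V))
      (prodPt (algebraMap E F ∘ α) z) := by
  obtain ⟨φ, hφ⟩ := exists_subst_prodPt (k := k) (F := F) (n := n) α
  intro f
  constructor
  · intro hf
    rw [mem_vanishingIdeal_iff]
    rintro _ ⟨v, hv, rfl⟩
    rw [← hφ]
    refine hgen _ ?_ v (hVW hv)
    rw [hφ]
    exact hf
  · intro hf
    exact (mem_vanishingIdeal_iff.1 hf) _ ⟨z, hzV, rfl⟩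

end GenericTransfer

/-! ### Images under `[M]` over a subfield, and the transfer of strong rotundity -/

section Image

variable {F : Type u} [Field F] {k : Type u} [Field k] [Algebra k F] {N : ℕ}

/-- **Polynomials over `k` vanishing on `[M] S` are those vanishing at `[M] p`**, for `p` a generic
point over `k` of (the `k`-closure of) a set `S` of torus points (two-field form of
`Literature.NumberTheory.Transcendental.mem_vanishingIdeal_image_matrixAct_iff`: clear denominators
in `h ∘ [M]`). [cite: BaysKirby2018ANT, Prop. 7.3 (proof)] -/
theorem mem_vanishingIdeal_image_matrixAct_iff' {S : Set (Fin N ⊕ Fin N → F)}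
    (hS : S ⊆ torusLocus F N) {p : Fin N ⊕ Fin N → F}
    (hp : IsGenericPt (vanishingIdeal k S) p) (hpT : p ∈ torusLocus F N)
    (M : Matrix (Fin N) (Fin N) ℤ) (h : MvPolynomial (Fin N ⊕ Fin N) k) :
    h ∈ vanishingIdeal k (matrixAct M '' S) ↔ aeval (matrixAct M p) h = 0 := by
  obtain ⟨N', a, hNa⟩ := exists_mul_prod_pow_eq_aeval M h
  have hprodp : (∏ i, p (Sum.inr i)) ^ N' ≠ 0 :=
    pow_ne_zero _ (Finset.prod_ne_zero_iff.2 fun i _ => hpT i)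
  constructor
  · intro hh
    have ha : a ∈ vanishingIdeal k S := by
      rw [mem_vanishingIdeal_iff]
      intro z hz
      rw [← hNa z (hS hz), (mem_vanishingIdeal_iff.1 hh) _ ⟨z, hz, rfl⟩, zero_mul]
    have := hNa p hpT
    rw [(hp a).2 ha] at this
    exact (mul_eq_zero.1 this).resolve_right hprodp
  · intro hh
    rw [mem_vanishingIdeal_iff]
    rintro _ ⟨z, hz, rfl⟩
    have ha : a ∈ vanishingIdeal k S := by
      rw [← hp a, ← hNa p hpT, hh, zero_mul]
    have h0 : aeval z a = 0 := (mem_vanishingIdeal_iff.1 ha) z hz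
    have := hNa z (hS hz)
    rw [h0] at this
    exact (mul_eq_zero.1 this).resolve_right
      (pow_ne_zero _ (Finset.prod_ne_zero_iff.2 fun i _ => hS hz i))

/-- `[M] p` is a generic point over `k` of the `k`-closure of `[M] S`. [cite: BaysKirby2018ANT, Prop. 7.3 (proof)] -/
theorem isGenericPt_vanishingIdeal_image_matrixAct {S : Set (Fin N ⊕ Fin N → F)}
    (hS : S ⊆ torusLocus F N) {p : Fin N ⊕ Fin N → F}
    (hp : IsGenericPt (vanishingIdeal k S) p) (hpT : p ∈ torusLocus F N)
    (M : Matrix (Fin N) (Fin N) ℤ) :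
    IsGenericPt (vanishingIdeal k (matrixAct M '' S)) (matrixAct M p) := fun h =>
  (mem_vanishingIdeal_image_matrixAct_iff' hS hp hpT M h).symm

/-- **The dimension of `[M] S` over `F` is at most the transcendence degree of `k[[M] p]`** for
`p` generic over `k`: `zariskiDim F ([M] S) ≤ trdeg_k k[[M] p]` (the `F`-closure is at most the
`k`-closure, `Literature.RingTheory.KrullDimension.ringKrullDim_quotient_vanishingIdeal_le`, whose
coordinate ring is `k[[M] p]`). [cite: BaysKirby2018ANT, Prop. 7.3 (proof)] -/
theorem zariskiDim_image_matrixAct_le_trdeg {S : Set (Fin N ⊕ Fin N → F)}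
    (hS : S ⊆ torusLocus F N) {p : Fin N ⊕ Fin N → F}
    (hp : IsGenericPt (vanishingIdeal k S) p) (hpT : p ∈ torusLocus F N)
    (M : Matrix (Fin N) (Fin N) ℤ) :
    zariskiDim F (matrixAct M '' S) ≤
      (Cardinal.toNat (Algebra.trdeg k (Algebra.adjoin k (range (matrixAct M p)))) : WithBot ℕ∞) := by
  set Q : Ideal (MvPolynomial (Fin N ⊕ Fin N) k) := vanishingIdeal k (matrixAct M '' S) with hQ
  have hgen : IsGenericPt Q (matrixAct M p) := isGenericPt_vanishingIdeal_image_matrixAct hS hp hpT M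
  have hker := (isGenericPt_iff_ker_eq Q (matrixAct M p)).1 hgen
  haveI : Q.IsPrime := hker ▸ RingHom.ker_isPrime _
  haveI : IsDomain (zeroLocusCoordRing Q) := Ideal.Quotient.isDomain Q
  have h1 : zariskiDim F (matrixAct M '' S) ≤ ringKrullDim (zeroLocusCoordRing Q) :=
    Literature.RingTheory.KrullDimension.ringKrullDim_quotient_vanishingIdeal_le (k := k) _
  rw [Literature.RingTheory.KrullDimension.ringKrullDim_eq_trdeg k,
    trdeg_coordRing_eq_of_isGenericPt hgen] at h1
  exact h1

end Image

/-! ### Bridges: relative rank over a subfield -/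

section Bridges

variable {F : Type u} [Field F] [CharZero F]

/-- The image of `ℚ` lies in every subfield (characteristic zero). [folklore] -/
theorem algebraMap_rat_mem (S : Subfield F) (q : ℚ) : algebraMap ℚ F q ∈ S := by
  rw [eq_ratCast]
  exact SubfieldClass.ratCast_mem S q

/-- **`trdeg` over a subfield is relative rank**: `toENat (trdeg_S S[T]) = relRank S T` in the
algebraic matroid of `F/ℚ` (`GammaField.toENat_trdeg_adjoin_eq_relRank` on the subfield `S` read
as an intermediate field of `F/ℚ`). [folklore] -/
theorem toENat_trdeg_adjoin_subfield_eq_relRank (S : Subfield F) (T : Set F) :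
    Cardinal.toENat (Algebra.trdeg S (Algebra.adjoin S T)) = (algMatroid F).relRank (S : Set F) T :=
  toENat_trdeg_algebra_adjoin_eq_relRank (S.toIntermediateField (algebraMap_rat_mem S)) T

/-- A natural-number bound on a transcendence degree over a subfield bounds the relative rank.
[folklore] -/
theorem relRank_le_of_trdeg_le (S : Subfield F) (T : Set F) {d : ℕ}
    (h : Algebra.trdeg S (Algebra.adjoin S T) ≤ d) : (algMatroid F).relRank (S : Set F) T ≤ d := by
  rw [← toENat_trdeg_adjoin_subfield_eq_relRank]
  have := Cardinal.toENat.monotone' h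
  simpa using this

/-- A natural-number lower bound on `toNat` of a (finite) transcendence degree bounds the relative
rank from below. [folklore] -/
theorem le_relRank_of_le_toNat_trdeg (S : Subfield F) (T : Set F) {d : ℕ}
    (hfin : Algebra.trdeg S (Algebra.adjoin S T) = Cardinal.toNat (Algebra.trdeg S (Algebra.adjoin S T)))
    (h : d ≤ Cardinal.toNat (Algebra.trdeg S (Algebra.adjoin S T))) :
    (d : ℕ∞) ≤ (algMatroid F).relRank (S : Set F) T := by
  rw [← toENat_trdeg_adjoin_subfield_eq_relRank, hfin]
  simpa using h

end Bridges

/-! ### Γ-field bookkeeping -/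

section GammaBookkeeping

variable {F : Type u} [Field F] [CharZero F] [Literature.ModelTheory.ExponentialFields.ExponentialRing F]

/-- The closure of `K₀ ∪ {a, exp a}` in the algebraic matroid is that of the generators of the
Γ-field of `K + ℚa`. [folklore] -/
theorem closure_fieldOf_union_range_gammaPt (K : Submodule ℚ F) {r : ℕ} (a : Fin r → F) :
    (algMatroid F).closure ((fieldOf K : Set F) ∪ range (gammaPt a)) =
      (algMatroid F).closure (gens (K ⊔ Submodule.span ℚ (range a))) := by
  change acl ((fieldOf K : Set F) ∪ range (gammaPt a)) = acl (gens (K ⊔ Submodule.span ℚ (range a)))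
  apply Subset.antisymm
  · refine acl_subset_acl_of_subset ?_
    rintro x (hx | ⟨j, rfl⟩)
    · exact acl_mono (gens_mono le_sup_left) (fieldOf_subset_acl K hx)
    · rcases j with (i | i)
      · exact subset_acl _ (mem_gens_of_mem
          (Submodule.mem_sup_right (Submodule.subset_span ⟨i, rfl⟩)))
      · exact subset_acl _ (exp_mem_gens
          (Submodule.mem_sup_right (Submodule.subset_span ⟨i, rfl⟩)))
  · refine acl_subset_acl_of_subset ((gens_sup_span_subset_acl K (range a)).trans (acl_mono ?_))
    rintro x (hx | hx)
    · exact Or.inl (gens_subset_fieldOf K hx)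
    · right
      rw [range_gammaPt]
      exact hx

/-- **`td((g, exp g) / K₀(a, exp a)) = td(ℚg / K + ℚa)`**: the relative rank of the coordinates
of `(g, exp g)` over `K₀ ∪ {a, exp a}` is the relative transcendence degree `td` of
`GammaFields.lean`. [cite: BaysKirby2018ANT, Def. 4.1] -/
theorem relRank_fieldOf_union_range_gammaPt (K : Submodule ℚ F) {r n : ℕ} (a : Fin r → F)
    (g : Fin n → F) :
    (algMatroid F).relRank ((fieldOf K : Set F) ∪ range (gammaPt a)) (range (gammaPt g)) =
      td (K ⊔ Submodule.span ℚ (range a)) (Submodule.span ℚ (range g)) := by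
  rw [← relRank_range_gammaPt K a g]
  exact (algMatroid F).relRank_congr_closure_left _
    ((closure_fieldOf_union_range_gammaPt K a).trans (closure_coe_bfld K a).symm)

/-- **`I_k(W ∩ G) = I_k({α} × V)`** for `W = Loc(α, V/K)` and `k ⊆ K₀`: the `K`-locus of
`{α} × V` and its torus part have the same polynomials over `k` vanishing on them as `{α} × V`
itself (for `α`, `V` inside the torus). [cite: BaysKirby2018ANT, Def. 11.1 (`W := Loc(α,β/K)`)] -/
theorem vanishingIdeal_locOver_inter_torusLocus (K : Submodule ℚ F) (k : Subfield F)
    (hk : k ≤ (fieldOf K).toSubfield) {r n : ℕ} {α : Fin r ⊕ Fin r → F}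
    (hα : α ∈ torusLocus F r) {V : Set (Fin n ⊕ Fin n → F)} (hV : V ⊆ torusLocus F n) :
    vanishingIdeal k (locOver K α V ∩ torusLocus F (r + n)) = vanishingIdeal k (prodPt α '' V) := by
  apply le_antisymm
  · refine vanishingIdeal_anti_mono ?_
    rintro _ ⟨v, hv, rfl⟩
    exact ⟨prodPt_mem_locOver K α hv, prodPt_mem_torusLocus hα (hV hv)⟩
  · intro f hf
    letI : Algebra k (fieldOf K).toSubfield := (Subfield.inclusion hk).toAlgebra
    haveI : IsScalarTower k (fieldOf K).toSubfield F := IsScalarTower.of_algebraMap_eq fun _ => rfl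
    have hf' : MvPolynomial.map (algebraMap k (fieldOf K).toSubfield) f ∈
        vanishingIdeal (fieldOf K).toSubfield (prodPt α '' V) := by
      rw [mem_vanishingIdeal_iff]
      intro x hx
      rw [aeval_map_algebraMap]
      exact (mem_vanishingIdeal_iff.1 hf) x hx
    rw [mem_vanishingIdeal_iff]
    rintro x ⟨hx, -⟩
    have := (mem_zeroLocus_iff.1 hx) _ hf'
    rwa [aeval_map_algebraMap] at this

end GammaBookkeeping

/-! ### The theorem -/

section Main

variable {F : Type u} [Field F] [CharZero F] [Literature.ModelTheory.ExponentialFields.ExponentialRing F]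

/-- **A Γ-point independent over `Γ(K) ∪ α`, from strong exponential-algebraic closedness** — the
conclusion of generic strong Γ-closedness (Bays–Kirby 2018, Def. 11.1) for a single pair
`(V, α)`, with the field of definition of `V` allowed to be *any subfield algebraic over `K₀(α)`*
(e.g. the full Γ-field `⟨K α⟩` with all division points `exp (a/m)`, see
`exists_gammaPt_linIndepOver_of_isDefinedOver_fieldOf`), not only `K(α) = K₀(a, exp a)` as in
`GammaField.IsGenericallyStronglyGammaClosedOver`. The proof is that described at
`isGenericallyStronglyGammaClosedOver_of_isStronglyExpAlgClosed` (module docstring); the extra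
generality costs nothing, since the finitely many defining coefficients are algebraic over
`ℚ(C₂, α)` for a finite `C₂ ⊆ K₀` (finitarity of the algebraic matroid).
[cite: BaysKirby2018ANT, Prop. 11.5 (proof), Def. 11.1] [cite: Zilber2005PseudoExp, §1 axiom (SEC), §5] -/
theorem exists_gammaPt_linIndepOver_of_isStronglyExpAlgClosed [IsAlgClosed F]
    (hSEAC : IsStronglyExpAlgClosed F) (K : Submodule ℚ F) {n r : ℕ}
    {W₀ : Set (Fin n ⊕ Fin n → F)} {a : Fin r → F} (hirr : IsIrreducibleClosed F W₀)
    (hne : (W₀ ∩ torusLocus F n).Nonempty) (hdim : zariskiDim F W₀ = n)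
    (hadd : IsAddFree F n (W₀ ∩ torusLocus F n)) (hmul : IsMulFree F n (W₀ ∩ torusLocus F n))
    (hrot : IsRotund F n (W₀ ∩ torusLocus F n)) (ha : LinIndepOver K a)
    (hX : IsStrong (K ⊔ Submodule.span ℚ (range a))) {S : Subfield F}
    (hS : (S : Set F) ⊆ acl ((fieldOf K : Set F) ∪ range (gammaPt a))) (hdef : IsDefinedOver S W₀)
    (hsrot : IsStronglyRotund F (r + n)
      (locOver K (gammaPt a) (W₀ ∩ torusLocus F n) ∩ torusLocus F (r + n))) :
    ∃ g : Fin n → F, gammaPt g ∈ W₀ ∧ LinIndepOver (K ⊔ Submodule.span ℚ (range a)) g := by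
  classical
  -- notation: `X = K + ℚa`, `K₀`, `Sa = {a, exp a}`
  set X : Submodule ℚ F := K ⊔ Submodule.span ℚ (range a) with hXdef
  set K₀ : Subfield F := (fieldOf K).toSubfield with hK₀
  have hK₀coe : (K₀ : Set F) = (fieldOf K : Set F) := rfl
  set Sa : Set F := range (gammaPt a) with hSa
  have hSafin : Sa.Finite := finite_range _
  /- (C1): a finite `C₁ ⊆ K₀` computing `td(α/K₀)`; (C2): a finite `C₂ ⊆ K₀` with `W₀` defined
    over `ℚ(C₂, α)`; `C = C₁ ∪ C₂` -/
  obtain ⟨C₁, hC₁K, hC₁fin, hC₁⟩ :=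
    (algMatroid F).exists_finite_subset_relRank_eq_of_ground_eq_univ
      (AlgebraicIndependent.matroid_e ℚ F) (C := (K₀ : Set F)) hSafin
  -- the defining coefficients `D ⊆ S`, and a finite `C₂ ⊆ K₀` with `D ⊆ acl (C₂ ∪ Sa)`
  obtain ⟨D, hDS, hdefD⟩ : ∃ D : Finset F, (D : Set F) ⊆ S ∧
      IsDefinedOver (Subfield.closure (D : Set F)) W₀ := by
    have h0 : IsDefinedOver (Subfield.closure ((S : Set F) ∪ ∅)) W₀ := by
      rw [Set.union_empty, Subfield.closure_eq]; exact hdef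
    obtain ⟨D, hDS, hD⟩ := h0.exists_finset_closure_union
    exact ⟨D, hDS, by rw [Set.union_empty] at hD; exact hD⟩
  obtain ⟨C₂, hC₂K, hC₂fin, hDC₂⟩ : ∃ C₂ : Set F, C₂ ⊆ K₀ ∧ C₂.Finite ∧
      (D : Set F) ⊆ acl (C₂ ∪ Sa) := by
    obtain ⟨I, hIsub, hIfin, -, hDI⟩ :=
      (algMatroid F).exists_subset_finite_closure_of_subset_closure D.finite_toSet
        (hDS.trans hS)
    refine ⟨I ∩ K₀, inter_subset_right, hIfin.inter_of_left _, hDI.trans (acl_mono ?_)⟩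
    intro x hx
    rcases hIsub hx with h | h
    · exact Or.inl ⟨hx, h⟩
    · exact Or.inr h
  obtain ⟨C, hC₁C, hC₂C, hCK⟩ : ∃ C : Finset F, C₁ ⊆ (C : Set F) ∧ C₂ ⊆ (C : Set F) ∧
      (C : Set F) ⊆ K₀ := by
    refine ⟨hC₁fin.toFinset ∪ hC₂fin.toFinset, ?_, ?_, ?_⟩
    · intro x hx
      rw [Finset.coe_union, Set.Finite.coe_toFinset, Set.Finite.coe_toFinset]
      exact Or.inl hx
    · intro x hx
      rw [Finset.coe_union, Set.Finite.coe_toFinset, Set.Finite.coe_toFinset]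
      exact Or.inr hx
    · intro x hx
      rw [Finset.coe_union, Set.Finite.coe_toFinset, Set.Finite.coe_toFinset] at hx
      exact hx.elim (fun h => hC₁K h) (fun h => hC₂K h)
  have hDC : (D : Set F) ⊆ acl ((C : Set F) ∪ Sa) :=
    hDC₂.trans (acl_mono (union_subset_union_left _ hC₂C))
  -- the finite set fed to SEAC
  obtain ⟨F₀, hF₀coe⟩ : ∃ F₀ : Finset F, (F₀ : Set F) = (C : Set F) ∪ Sa ∪ D :=
    ⟨C ∪ Finset.univ.image (gammaPt a) ∪ D, by
      rw [Finset.coe_union, Finset.coe_union, Finset.coe_image, Finset.coe_univ, Set.image_univ]⟩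
  /- the subfields `k₁ = ℚ(C) ⊆ K₀` and `L = ℚ(C, α, D)` (algebraic over `k₁(α)`), made opaque -/
  obtain ⟨k₁, L, hk₁K, hCk₁, hC1, hk₁L, hSaL, hLacl, hdefL, hLeq⟩ :
      ∃ k₁ L : Subfield F, k₁ ≤ K₀ ∧ (C : Set F) ⊆ k₁ ∧
        (algMatroid F).relRank (k₁ : Set F) Sa = (algMatroid F).relRank (K₀ : Set F) Sa ∧
        k₁ ≤ L ∧ Sa ⊆ L ∧ (L : Set F) ⊆ acl ((C : Set F) ∪ Sa) ∧ IsDefinedOver L W₀ ∧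
        Subfield.closure ((↑(∅ : Finset F) : Set F) ∪ ↑F₀) = L := by
    refine ⟨Subfield.closure (C : Set F), Subfield.closure ((C : Set F) ∪ Sa ∪ D),
      Subfield.closure_le.2 hCK, Subfield.subset_closure, ?_,
      Subfield.closure_mono (subset_union_left.trans subset_union_left),
      fun x hx => Subfield.subset_closure (Or.inl (Or.inr hx)), ?_,
      hdefD.of_le (Subfield.closure_mono subset_union_right), ?_⟩
    · apply le_antisymm
      · calc (algMatroid F).relRank (Subfield.closure (C : Set F) : Set F) Sa
            ≤ (algMatroid F).relRank C₁ Sa :=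
              (algMatroid F).relRank_anti_left Sa (hC₁C.trans Subfield.subset_closure)
          _ = (algMatroid F).relRank (K₀ : Set F) Sa := hC₁
      · exact (algMatroid F).relRank_anti_left Sa (Subfield.closure_le.2 hCK)
    · refine (subfieldClosure_subset_acl _).trans (acl_subset_acl_of_subset ?_)
      exact union_subset (subset_acl _) hDC
    · rw [Finset.coe_empty, Set.empty_union, hF₀coe]
  -- SEAC: a point `(g, exp g) ∈ V` generic over `L`
  have hdef₀ : IsDefinedOver (Subfield.closure (F₀ : Set F)) W₀ := by
    have : Subfield.closure (F₀ : Set F) = L := by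
      rw [← hLeq, Finset.coe_empty, Set.empty_union]
    rw [this]
    exact hdefL
  obtain ⟨z, ⟨hzW, hzexp⟩, hgen⟩ := hSEAC n W₀ hirr hne hrot hadd hmul hdim ∅ F₀ hdef₀
  rw [hLeq] at hgen
  set g : Fin n → F := z ∘ Sum.inl with hg
  have hzg : z = gammaPt g := (mem_expGraph_iff_eq_gammaPt z).1 hzexp
  refine ⟨g, hzg ▸ hzW, ?_⟩
  by_contra hdep
  /- the relation matrix of `ζ = (a, g)` over `K` -/
  obtain ⟨s, M, hrank, hrel, hldimζ⟩ := exists_relation_matrix K (Fin.append a g)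
  have hspanζ : K ⊔ Submodule.span ℚ (range (Fin.append a g)) = X ⊔ Submodule.span ℚ (range g) := by
    rw [span_range_append, ← sup_assoc]
  have hfgζ : IsFG K (X ⊔ Submodule.span ℚ (range g)) := by
    rw [← hspanζ, isFG_sup_left]
    exact isFG_span_of_finite K (finite_range _)
  have hldim1 : ldim K (Submodule.span ℚ (range (Fin.append a g))) =
      r + ldim X (Submodule.span ℚ (range g)) := by
    rw [← ldim_sup_left K, hspanζ, ldim_add (le_sup_left : K ≤ X) le_sup_left hfgζ, ldim_sup_left,
      hXdef, ldim_sup_left, ldim_span_eq_of_linIndepOver ha]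
  have hlt : ldim X (Submodule.span ℚ (range g)) < n := ldim_lt_of_not_linIndepOver hdep
  have hldimg : ldim X (Submodule.span ℚ (range g)) + s = n := by omega
  have hs1 : 1 ≤ s := by omega
  have hM0 : M ≠ 0 := by
    rintro rfl
    rw [Matrix.map_zero (Int.cast : ℤ → ℚ) Int.cast_zero, Matrix.rank_zero] at hrank
    omega
  /- the point `p = (α, z) = (ζ, exp ζ)` of `S = W ∩ G` (both made opaque) -/
  have hzV : z ∈ W₀ ∩ torusLocus F n := ⟨hzW, expGraph_subset_torusLocus hzexp⟩
  obtain ⟨S, hSdef⟩ : ∃ S : Set (Fin (r + n) ⊕ Fin (r + n) → F),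
      S = locOver K (gammaPt a) (W₀ ∩ torusLocus F n) ∩ torusLocus F (r + n) := ⟨_, rfl⟩
  rw [← hSdef] at hsrot
  obtain ⟨p, hp⟩ : ∃ p : Fin (r + n) ⊕ Fin (r + n) → F, p = prodPt (gammaPt a) z := ⟨_, rfl⟩
  have hpζ : p = gammaPt (Fin.append a g) := by rw [hp, hzg, prodPt_gammaPt]
  have hST : S ⊆ torusLocus F (r + n) := by rw [hSdef]; exact inter_subset_right
  have hpT : p ∈ torusLocus F (r + n) := by
    rw [hp]; exact prodPt_mem_torusLocus (gammaPt_mem_torusLocus a) hzV.2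
  /- `p` is generic over `k₁` in `S` -/
  have hgenp : IsGenericPt (vanishingIdeal k₁ S) p := by
    letI : Algebra k₁ L := (Subfield.inclusion hk₁L).toAlgebra
    haveI : IsScalarTower k₁ L F := IsScalarTower.of_algebraMap_eq fun _ => rfl
    let αL : Fin r ⊕ Fin r → L := fun j => ⟨gammaPt a j, hSaL ⟨j, rfl⟩⟩
    have hαL : (algebraMap L F ∘ αL) = gammaPt a := rfl
    have hgenL : ∀ f : MvPolynomial (Fin n ⊕ Fin n) L, aeval z f = 0 →
        ∀ v ∈ W₀, aeval v f = 0 := by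
      intro f hf v hv
      have h1 : f ∈ vanishingIdeal L ({z} : Set (Fin n ⊕ Fin n → F)) :=
        (mem_vanishingIdeal_singleton_iff z f).2 hf
      rw [hgen.2] at h1
      exact (mem_vanishingIdeal_iff.1 h1) v hv
    rw [hSdef, vanishingIdeal_locOver_inter_torusLocus K k₁ hk₁K (gammaPt_mem_torusLocus a)
      (inter_subset_right : W₀ ∩ torusLocus F n ⊆ torusLocus F n), hp]
    have := isGenericPt_vanishingIdeal_image_prodPt (k := k₁) αL
      (inter_subset_left : W₀ ∩ torusLocus F n ⊆ W₀) hzV hgenL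
    rwa [hαL] at this
  /- strong rotundity of `W`: `td([M] p / k₁) ≥ s + 1` -/
  have htM : ((s + 1 : ℕ) : ℕ∞) ≤ (algMatroid F).relRank (k₁ : Set F) (range (matrixAct M p)) := by
    have hsM : ((s : ℕ) : WithBot ℕ∞) < zariskiDim F (matrixAct M '' S) := by
      have := hsrot M hM0
      rwa [hrank] at this
    have h1 := lt_of_lt_of_le hsM (zariskiDim_image_matrixAct_le_trdeg hST hgenp hpT M)
    have h2 : s < Cardinal.toNat (Algebra.trdeg k₁ (Algebra.adjoin k₁ (range (matrixAct M p)))) := by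
      exact_mod_cast h1
    haveI : Algebra.FiniteType k₁ (Algebra.adjoin (k₁ : Subfield F) (range (matrixAct M p))) :=
      (Subalgebra.fg_iff_finiteType _).1 (Subalgebra.fg_def.2 ⟨_, finite_range _, rfl⟩)
    exact le_relRank_of_le_toNat_trdeg k₁ _
      (Literature.RingTheory.KrullDimension.trdeg_eq_toNat k₁ _) h2
  /- `[M] p` is `K₀`-rational -/
  have hMp : range (matrixAct M p) ⊆ (K₀ : Set F) := by
    rintro _ ⟨j, rfl⟩
    rw [hpζ, matrixAct_gammaPt]
    rcases j with (i | i)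
    · rw [gammaPt_inl]; exact mem_fieldOf_of_mem (hrel i)
    · rw [gammaPt_inr]; exact exp_mem_fieldOf (hrel i)
  /- points of the `n`-dimensional `V` have `td ≤ n` over its field of definition `L` -/
  have hI2 : (algMatroid F).relRank (L : Set F) (range z) ≤ n := by
    obtain ⟨J, hJ⟩ := hdefL
    have hd : ringKrullDim (MvPolynomial (Fin n ⊕ Fin n) F ⧸ vanishingIdeal F W₀) = n := hdim
    exact relRank_le_of_trdeg_le L _
      (Literature.RingTheory.KrullDimension.trdeg_adjoin_le_of_mem J hJ hirr.2 hd hzW)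
  /- === the count, in the algebraic matroid of `F/ℚ` === -/
  have hSp : range p = Sa ∪ range z := by rw [hp, range_prodPt]
  have hA : (algMatroid F).relRank (K₀ : Set F) Sa < ⊤ :=
    (algMatroid F).relRank_lt_top_of_finite _ (hSafin.subset sdiff_subset)
  -- additivity: `relRank B p = relRank B Sa + relRank (B ∪ Sa) z`
  have hadd' : ∀ B : Set F, (algMatroid F).relRank B Sa + (algMatroid F).relRank (B ∪ Sa) (range z) =
      (algMatroid F).relRank B (range p) := by
    intro B
    rw [← (algMatroid F).relRank_union_self_left B Sa, (algMatroid F).relRank_add_relRank'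
      subset_union_left (range z), union_assoc, (algMatroid F).relRank_union_self_left, hSp]
  -- strongness of `X`: `td(g/X) ≥ ldim(g/X) = n - s`
  have htd : ((n - s : ℕ) : ℕ∞) ≤ (algMatroid F).relRank ((K₀ : Set F) ∪ Sa) (range z) := by
    have hfg : IsFG X (Submodule.span ℚ (range g)) := isFG_span_of_finite X (finite_range g)
    have hδ : 0 ≤ predim X (Submodule.span ℚ (range g)) := (isStrong_iff.1 hX) _ hfg
    rw [predim_def] at hδ
    have h1 : n - s ≤ (td X (Submodule.span ℚ (range g))).toNat := by omega
    rw [hK₀coe, hSa, hzg, relRank_fieldOf_union_range_gammaPt K a g,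
      ← ENat.coe_toNat (td_ne_top hfg)]
    exact_mod_cast h1
  -- lower bound for `td(p/K₀)`
  have hlow : (algMatroid F).relRank (K₀ : Set F) Sa + ((n - s : ℕ) : ℕ∞) ≤
      (algMatroid F).relRank (K₀ : Set F) (range p) := by
    rw [← hadd']
    exact add_le_add le_rfl htd
  -- upper bound: `td(p/K₀) ≤ td(p / k₁ ∪ [M]p) = td(p/k₁) - td([M]p/k₁)`
  have hup1 : (algMatroid F).relRank (K₀ : Set F) (range p) ≤
      (algMatroid F).relRank ((k₁ : Set F) ∪ range (matrixAct M p)) (range p) :=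
    (algMatroid F).relRank_anti_left _ (union_subset hk₁K hMp)
  have hup2 : (algMatroid F).relRank (k₁ : Set F) (range (matrixAct M p)) +
      (algMatroid F).relRank ((k₁ : Set F) ∪ range (matrixAct M p)) (range p) =
        (algMatroid F).relRank (k₁ : Set F) (range p) := by
    rw [← (algMatroid F).relRank_union_self_left (k₁ : Set F) (range (matrixAct M p)),
      (algMatroid F).relRank_add_relRank' subset_union_left (range p), union_assoc,
      (algMatroid F).relRank_union_self_left]
    refine (algMatroid F).relRank_congr_closure _ ?_
    -- `[M] p ⊆ closure (p ∪ k₁)`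
    have hsub : range (matrixAct M p) ⊆ (algMatroid F).closure (range p ∪ (k₁ : Set F)) := by
      rintro x ⟨j, rfl⟩
      refine (algMatroid F).closure_subset_closure subset_union_left ?_
      exact subfieldClosure_subset_acl _ (matrixAct_mem_closure_range M p j)
    apply Subset.antisymm
    · rw [union_assoc]
      calc (algMatroid F).closure (range (matrixAct M p) ∪ (range p ∪ (k₁ : Set F)))
          ⊆ (algMatroid F).closure ((algMatroid F).closure (range p ∪ (k₁ : Set F)) ∪
              (range p ∪ (k₁ : Set F))) :=
            (algMatroid F).closure_subset_closure (union_subset_union_left _ hsub)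
        _ = (algMatroid F).closure (range p ∪ (k₁ : Set F)) := by
            rw [Matroid.closure_union_closure_left_eq, union_self]
    · exact (algMatroid F).closure_subset_closure
        (by rw [union_assoc]; exact subset_union_right)
  have hup3 : (algMatroid F).relRank ((k₁ : Set F) ∪ Sa) (range z) ≤ n := by
    have hcl : (algMatroid F).closure ((k₁ : Set F) ∪ Sa) = (algMatroid F).closure (L : Set F) := by
      change acl ((k₁ : Set F) ∪ Sa) = acl (L : Set F)
      apply Subset.antisymm
      · refine acl_subset_acl_of_subset ((union_subset ?_ hSaL).trans (subset_acl _))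
        exact fun x hx => hk₁L hx
      · exact acl_subset_acl_of_subset (hLacl.trans (acl_mono (union_subset_union_left _ hCk₁)))
    rw [(algMatroid F).relRank_congr_closure_left (range z) hcl]
    exact hI2
  have hup : (algMatroid F).relRank (k₁ : Set F) (range p) ≤
      (algMatroid F).relRank (K₀ : Set F) Sa + n := by
    rw [← hadd', hC1]
    exact add_le_add le_rfl hup3
  -- the contradiction `(s + 1) + A + (n - s) ≤ A + n`
  have key : ((s + 1 : ℕ) : ℕ∞) + ((algMatroid F).relRank (K₀ : Set F) Sa + ((n - s : ℕ) : ℕ∞)) ≤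
      (algMatroid F).relRank (K₀ : Set F) Sa + n :=
    calc ((s + 1 : ℕ) : ℕ∞) + ((algMatroid F).relRank (K₀ : Set F) Sa + ((n - s : ℕ) : ℕ∞))
        ≤ (algMatroid F).relRank (k₁ : Set F) (range (matrixAct M p)) +
            (algMatroid F).relRank ((k₁ : Set F) ∪ range (matrixAct M p)) (range p) :=
          add_le_add htM (hlow.trans hup1)
      _ = (algMatroid F).relRank (k₁ : Set F) (range p) := hup2
      _ ≤ (algMatroid F).relRank (K₀ : Set F) Sa + n := hup
  obtain ⟨A, hAeq⟩ := ENat.ne_top_iff_exists.1 hA.ne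
  rw [← hAeq] at key
  have key' : (s + 1) + (A + (n - s)) ≤ A + n := by exact_mod_cast key
  omega

/-- **Strong exponential-algebraic closedness implies generic strong Γ-closedness over every `K`.**
Let `F` be algebraically closed and strongly exponentially-algebraically closed
(`Literature.NumberTheory.Transcendental.IsStronglyExpAlgClosed`, Zilber's axiom; Bays–Kirby's
"axiom 4"). Then `F` is generically strongly Γ-closed over every `ℚ`-subspace `K`
(`GammaField.IsGenericallyStronglyGammaClosedOver`, Bays–Kirby 2018, Def. 11.1): for `V ⊆ Gⁿ`
irreducible, free and rotund of dimension `n`, defined over `K(α)` with `α = (a, exp a)`,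
`a` linearly independent over `K`, `K + ℚa ◁ F` and `W = Loc(α, V/K)` strongly rotund, there is
`(g, exp g) ∈ V` with `g` linearly independent over `K + ℚa`.

This is the conclusion of Bays–Kirby's Prop. 11.5 (there: GΓC ⟹ GSΓC over Γ-closed `K`, via the
weak Zilber–Pink theorem), obtained here directly from *strong* exponential-algebraic closedness
by the argument of that proof with the minimal coset in place of the weak-Zilber–Pink subgroup and
genericity over finitely generated fields in place of Zariski density. Proof: choose a finitely
generated subfield `k ⊆ K₀` over which `td(α/k) = td(α/K₀)`
(`Matroid.exists_finite_subset_relRank_eq`) and such that `V` is defined over `L = k(α)`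
(`IsDefinedOver.exists_finset_closure_union`); SEAC gives `(g, exp g) ∈ V` generic over `L`.
If `g` were dependent over `K + ℚa`, take the integer matrix `M ≠ 0` of all relations of
`ζ = (a, g)` over `K` (`exists_relation_matrix`, rank `s ≥ 1`, `ldim(g/K + ℚa) = n - s`). Then
`p = (ζ, exp ζ) ∈ W` is generic over `k` in `W` (`isGenericPt_vanishingIdeal_image_prodPt`) while
`[M] p` is `K₀`-rational; strong rotundity of `W` transfers to `td([M] p / k) ≥ s + 1`
(`zariskiDim_image_matrixAct_le_trdeg`); and the transcendence degree of `p` over `K₀` is on the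
one hand `≥ td(α/K₀) + (n - s)` (strongness of `K + ℚa`), on the other hand
`≤ td(p/k) - td([M]p/k) ≤ td(α/K₀) + n - (s + 1)` (`[M] p ⊆ K₀`; points of the `n`-dimensional
`V` have `td ≤ n` over `L`, `trdeg_adjoin_le_of_mem`) — a contradiction.
[cite: BaysKirby2018ANT, Prop. 11.5 (proof), Def. 11.1] [cite: Zilber2005PseudoExp, §1 axiom (SEC), §5] -/
theorem isGenericallyStronglyGammaClosedOver_of_isStronglyExpAlgClosed [IsAlgClosed F]
    (hSEAC : IsStronglyExpAlgClosed F) (K : Submodule ℚ F) :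
    IsGenericallyStronglyGammaClosedOver K :=
  fun _ _ _ _ hirr hne hdim hadd hmul hrot ha hX hdef hsrot =>
    exists_gammaPt_linIndepOver_of_isStronglyExpAlgClosed hSEAC K hirr hne hdim hadd hmul hrot ha hX
      (subfieldClosure_subset_acl _) hdef hsrot

/-- **The same with `V` defined over the full Γ-field `⟨K α⟩ = ℚ(Γ(K + ℚa))`** (all division
points `exp (a/m)` allowed as coefficients): the form in which the locus of a good basis over
`A = ⟨K c⟩` arises in the proof of Bays–Kirby's Prop. 11.2.
[cite: BaysKirby2018ANT, Def. 11.1, Prop. 11.2 (proof)] -/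
theorem exists_gammaPt_linIndepOver_of_isDefinedOver_fieldOf [IsAlgClosed F]
    (hSEAC : IsStronglyExpAlgClosed F) (K : Submodule ℚ F) {n r : ℕ}
    {W₀ : Set (Fin n ⊕ Fin n → F)} {a : Fin r → F} (hirr : IsIrreducibleClosed F W₀)
    (hne : (W₀ ∩ torusLocus F n).Nonempty) (hdim : zariskiDim F W₀ = n)
    (hadd : IsAddFree F n (W₀ ∩ torusLocus F n)) (hmul : IsMulFree F n (W₀ ∩ torusLocus F n))
    (hrot : IsRotund F n (W₀ ∩ torusLocus F n)) (ha : LinIndepOver K a)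
    (hX : IsStrong (K ⊔ Submodule.span ℚ (range a)))
    (hdef : IsDefinedOver (fieldOf (K ⊔ Submodule.span ℚ (range a))).toSubfield W₀)
    (hsrot : IsStronglyRotund F (r + n)
      (locOver K (gammaPt a) (W₀ ∩ torusLocus F n) ∩ torusLocus F (r + n))) :
    ∃ g : Fin n → F, gammaPt g ∈ W₀ ∧ LinIndepOver (K ⊔ Submodule.span ℚ (range a)) g := by
  refine exists_gammaPt_linIndepOver_of_isStronglyExpAlgClosed hSEAC K hirr hne hdim hadd hmul hrot
    ha hX ?_ hdef hsrot
  change (fieldOf (K ⊔ Submodule.span ℚ (range a)) : Set F) ⊆ _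
  refine (fieldOf_subset_acl _).trans ?_
  change (algMatroid F).closure _ ⊆ (algMatroid F).closure _
  rw [closure_fieldOf_union_range_gammaPt K a]

/-- **Zilber fields are generically strongly Γ-closed over every `K`** (a Zilber field is
algebraically closed and strongly exponentially-algebraically closed).
[cite: BaysKirby2018ANT, Prop. 11.5, Def. 11.1] [cite: Zilber2005PseudoExp, §1] -/
theorem _root_.Literature.NumberTheory.Transcendental.IsZilberField.isGenericallyStronglyGammaClosedOver
    (hK : IsZilberField F) (K : Submodule ℚ F) : IsGenericallyStronglyGammaClosedOver K := by
  haveI := hK.isAlgClosed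
  exact isGenericallyStronglyGammaClosedOver_of_isStronglyExpAlgClosed hK.isStronglyExpAlgClosed K

end Main

end ZilberGSGC

end Literature.NumberTheory.Transcendental
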